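import Mathlib
import HarnessLib
import Summits.HubbardSuperconductivity.HubbardSuperconductivity.Theorems.KLProgrammeKLRegimeEnginePairTransferMemberFlow
import Summits.HubbardSuperconductivity.HubbardSuperconductivity.Theorems.KLProgrammeKLRegimeSplitEdgeFactsRungProfile

/-!
# Route `KLProgramme` — ENGINE child gen 8 (stmt-HubbardSuperconductivity-20437 `KLRegimeEngineV17F2`), skeleton v2 class #5 rev 3:
# a `t`-UNIFORM MODEL PROFILE of the running relative weight — `klmf_norm_relWeight_le_profile`
# (cell gate-hubbard-kl, seat hubbard-kl-k3c1-p1 g15, technique «composed-map remainder propagation»; row 62 of CLASS5-RESOLVED-STEP.md, evidence #55 on 20437)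

WHY.  The resolved class-#5 STEP (rows 60/61: `…RelResAnalyticResolvedSplit`, `…Step7AnalyticResolved`) reads the member Riccati defects only CONVOLVED against a
`t`-uniform profile `α(c) ≥ ‖a(t)(c)‖` of the running relative weight `a(t) = (b₁(t) − b₂(t)) − (t_{n+1}[ψ₁] − t_{n+1}[ψ₂]) − (b₁(1) − b₂(1))` of the pair `(ψ₁ | ψ₂)`
(`bᵢ(t) = −B(φᵢ(t), φᵢ(t))`, `φᵢ(t) = ψᵢ + (w_{Λₙ₊₁} − w_{Λ(t)})`; `klmf_rung_data` / `klmf_relWeight_data`).  Since `φ₁(t) − φ₂(t) = ψ₁ − ψ₂ =: D` does not depend on `t`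
and `φᵢ(t) − φᵢ(1) = w_{Λₙ₊₁} − w_{Λ(t)} ∈ [0, s]` pointwise (`s = s^K_{n,n+1}`, `runningSlice_mem`), bilinearity of the pair mass gives, with NO integration,
`a(t)(c) = −(t_{n+1}[ψ₁] − t_{n+1}[ψ₂])(c) − (B(D, φ₁(t) − φ₁(1)) + B(φ₂(t) − φ₂(1), D))(c)` (`klrw_relWeight_value`), hence
  **`‖a(t)(c)‖ ≤ |t_{n+1}[ψ₁](c) − t_{n+1}[ψ₂](c)| + Maj(D, s)(c) + Maj(s, D)(c)`** for every `t ∈ [0,1]`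
— the α-row of rows 60/61 is a MODEL profile: the pinned transfer-weight difference of the pair plus the two bubble majorants of the `D`-line against the slice symbol (for the
cutoff-built pairs `D = s_{n+1,j} − s_{n+1,j′}`, a deep line: masses `∝ klIdxMass n j′`; windowed masses = the «(ᾱ)-WINDOW» supplier row, p1 (W2) / k3c2-p2 `D`-line lane).
Algebra over landed model lemmas; nothing asserts (X).3, (c), K3 or superconductivity.  0 kit · 0 lit.
-/

noncomputable section

namespace Summit.HubbardSuperconductivity.HubbardSuperconductivity.Theorems.KLRegimeSplit

set_option linter.dupNamespace false -- summit = problem name (single-conjunct summit), D-0017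

open Finset Set Literature.MathematicalPhysics.QuantumLattice Literature.Probability.LatticeModels
open Summit.HubbardSuperconductivity.HubbardSuperconductivity.Theorems.KLProgrammeLegKernels
open Summit.HubbardSuperconductivity.HubbardSuperconductivity.Theorems.DispersionFlow
open Summit.HubbardSuperconductivity.HubbardSuperconductivity.Theorems.KLRegimeWick

section RelWeightProfile

variable {L M : ℕ} [NeZero L] (β μ : ℝ) (K : TrigPolyC4v)

omit [NeZero L] in
/-- Difference of the pair masses of two symbols: `B(a₁,a₁) − B(a₂,a₂) = B(a₁ − a₂, a₁) + B(a₂, a₁ − a₂)`. -/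
theorem klrw_klBubbleMass_sq_sub_sq (a₁ a₂ : FreqMomentum L M → ℝ) (Qm p : TorusSite 2 L) :
    klBubbleMass L M β μ K a₁ a₁ Qm p - klBubbleMass L M β μ K a₂ a₂ Qm p =
      klBubbleMass L M β μ K (fun k => a₁ k - a₂ k) a₁ Qm p + klBubbleMass L M β μ K a₂ (fun k => a₁ k - a₂ k) Qm p := by
  have e₁ : a₁ = (fun k => a₁ k - a₂ k) + a₂ := by funext k; simp
  have h1 : klBubbleMass L M β μ K a₁ a₁ Qm p = klBubbleMass L M β μ K (fun k => a₁ k - a₂ k) a₁ Qm p + klBubbleMass L M β μ K a₂ a₁ Qm p := by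
    conv_lhs => rw [e₁]
    rw [klBubbleMass_add_left, ← e₁]
  have h2 : klBubbleMass L M β μ K a₂ a₁ Qm p = klBubbleMass L M β μ K a₂ (fun k => a₁ k - a₂ k) Qm p + klBubbleMass L M β μ K a₂ a₂ Qm p := by
    conv_lhs => rw [e₁]
    rw [klBubbleMass_add_right]
  rw [h1, h2]; ring

omit [NeZero L] in
/-- `B(a,b₁) − B(a,b₂) = B(a, b₁ − b₂)`. -/
theorem klrw_klBubbleMass_sub_right (a b₁ b₂ : FreqMomentum L M → ℝ) (Qm p : TorusSite 2 L) :
    klBubbleMass L M β μ K a b₁ Qm p - klBubbleMass L M β μ K a b₂ Qm p = klBubbleMass L M β μ K a (fun k => b₁ k - b₂ k) Qm p := by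
  have e : b₁ = (fun k => b₁ k - b₂ k) + b₂ := by funext k; simp
  conv_lhs => rw [e]
  rw [klBubbleMass_add_right]; ring

omit [NeZero L] in
/-- `B(b₁,a) − B(b₂,a) = B(b₁ − b₂, a)`. -/
theorem klrw_klBubbleMass_sub_left (a b₁ b₂ : FreqMomentum L M → ℝ) (Qm p : TorusSite 2 L) :
    klBubbleMass L M β μ K b₁ a Qm p - klBubbleMass L M β μ K b₂ a Qm p = klBubbleMass L M β μ K (fun k => b₁ k - b₂ k) a Qm p := by
  have e : b₁ = (fun k => b₁ k - b₂ k) + b₂ := by funext k; simp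
  conv_lhs => rw [e]
  rw [klBubbleMass_add_left]; ring

omit [NeZero L] in
/-- **The value of the running relative weight (real form).**  For symbols `ψ₁ ψ₂`, running parts `δt δ1` and a transfer difference `T`:
`(−B(ψ₁+δt,ψ₁+δt) + B(ψ₂+δt,ψ₂+δt)) + (−T − (−B(ψ₁+δ1,ψ₁+δ1) + B(ψ₂+δ1,ψ₂+δ1))) = −T − (B(ψ₁−ψ₂, δt−δ1) + B(δt−δ1, ψ₁−ψ₂))`. -/
theorem klrw_relWeight_value (ψ₁ ψ₂ δt δ1 : FreqMomentum L M → ℝ) (T : ℝ) (Qm c : TorusSite 2 L) :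
    (-klBubbleMass L M β μ K (fun k => ψ₁ k + δt k) (fun k => ψ₁ k + δt k) Qm c - -klBubbleMass L M β μ K (fun k => ψ₂ k + δt k) (fun k => ψ₂ k + δt k) Qm c) +
        (-T - (-klBubbleMass L M β μ K (fun k => ψ₁ k + δ1 k) (fun k => ψ₁ k + δ1 k) Qm c -
          -klBubbleMass L M β μ K (fun k => ψ₂ k + δ1 k) (fun k => ψ₂ k + δ1 k) Qm c)) =
      -T - (klBubbleMass L M β μ K (fun k => ψ₁ k - ψ₂ k) (fun k => δt k - δ1 k) Qm c +
        klBubbleMass L M β μ K (fun k => δt k - δ1 k) (fun k => ψ₁ k - ψ₂ k) Qm c) := by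
  have hDt : (fun k => (ψ₁ k + δt k) - (ψ₂ k + δt k)) = fun k => ψ₁ k - ψ₂ k := by funext k; ring
  have hD1 : (fun k => (ψ₁ k + δ1 k) - (ψ₂ k + δ1 k)) = fun k => ψ₁ k - ψ₂ k := by funext k; ring
  have hXt := klrw_klBubbleMass_sq_sub_sq β μ K (fun k => ψ₁ k + δt k) (fun k => ψ₂ k + δt k) Qm c
  have hX1 := klrw_klBubbleMass_sq_sub_sq β μ K (fun k => ψ₁ k + δ1 k) (fun k => ψ₂ k + δ1 k) Qm c
  simp only [hDt] at hXt
  simp only [hD1] at hX1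
  have hd1 : (fun k => (ψ₁ k + δt k) - (ψ₁ k + δ1 k)) = fun k => δt k - δ1 k := by funext k; ring
  have hd2 : (fun k => (ψ₂ k + δt k) - (ψ₂ k + δ1 k)) = fun k => δt k - δ1 k := by funext k; ring
  have hsub1 := klrw_klBubbleMass_sub_right β μ K (fun k => ψ₁ k - ψ₂ k) (fun k => ψ₁ k + δt k) (fun k => ψ₁ k + δ1 k) Qm c
  have hsub2 := klrw_klBubbleMass_sub_left β μ K (fun k => ψ₁ k - ψ₂ k) (fun k => ψ₂ k + δt k) (fun k => ψ₂ k + δ1 k) Qm c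
  simp only [hd1] at hsub1
  simp only [hd2] at hsub2
  linarith

omit [NeZero L] in
set_option maxHeartbeats 400000 in -- long model expressions (the rung weights of `klmf_rung_data`); pre-empts the 180k cliff probe
/-- **A `t`-uniform MODEL PROFILE of the running relative weight** (row 62 of CLASS5-RESOLVED-STEP): for the pair `(ψ₁ | ψ₂)` at scale `n+1`, frame `K`, class `Qm`, with the
rung weights `bᵢ` of `klmf_rung_data` and the relative weight `a` of `klmf_relWeight_data` (pass the defining equations), every `t ∈ [0,1]` and every loop label `c`:
`‖a(t)(c)‖ ≤ |t^K_{n+1}[ψ₁](Qm,c) − t^K_{n+1}[ψ₂](Qm,c)| + Maj(ψ₁ − ψ₂, s^K_{n,n+1})(Qm,c) + Maj(s^K_{n,n+1}, ψ₁ − ψ₂)(Qm,c)` (`0 < β`). -/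
theorem klmf_norm_relWeight_le_profile (hβ : 0 < β) (n : ℕ) (ψ₁ ψ₂ : FreqMomentum L M → ℝ) (Qm : TorusSite 2 L) (b₁ b₂ a : ℝ → TorusSite 2 L → ℂ)
    (hb₁def : b₁ = fun t p => -((klBubbleMass L M β μ K
        (fun k => ψ₁ k + (hubbardCutoffWeightCT L M β μ K (klScale klE0 (n + 1)) k -
          hubbardCutoffWeightCT L M β μ K (klScale klE0 n + t * (klScale klE0 (n + 1) - klScale klE0 n)) k))
        (fun k => ψ₁ k + (hubbardCutoffWeightCT L M β μ K (klScale klE0 (n + 1)) k -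
          hubbardCutoffWeightCT L M β μ K (klScale klE0 n + t * (klScale klE0 (n + 1) - klScale klE0 n)) k)) Qm p : ℝ) : ℂ))
    (hb₂def : b₂ = fun t p => -((klBubbleMass L M β μ K
        (fun k => ψ₂ k + (hubbardCutoffWeightCT L M β μ K (klScale klE0 (n + 1)) k -
          hubbardCutoffWeightCT L M β μ K (klScale klE0 n + t * (klScale klE0 (n + 1) - klScale klE0 n)) k))
        (fun k => ψ₂ k + (hubbardCutoffWeightCT L M β μ K (klScale klE0 (n + 1)) k -
          hubbardCutoffWeightCT L M β μ K (klScale klE0 n + t * (klScale klE0 (n + 1) - klScale klE0 n)) k)) Qm p : ℝ) : ℂ))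
    (hadef : a = fun t p => (b₁ t p - b₂ t p) +
      (-(((klTransferWeight L M β μ K (n + 1) ψ₁ Qm p - klTransferWeight L M β μ K (n + 1) ψ₂ Qm p : ℝ)) : ℂ) - (b₁ 1 p - b₂ 1 p)))
    {t : ℝ} (ht : t ∈ Icc (0 : ℝ) 1) (c : TorusSite 2 L) :
    ‖a t c‖ ≤ |klTransferWeight L M β μ K (n + 1) ψ₁ Qm c - klTransferWeight L M β μ K (n + 1) ψ₂ Qm c| +
      (klBubbleMaj L M β μ K (fun k => ψ₁ k - ψ₂ k) (softSymbolCompl L M β μ K n (n + 1)) Qm c +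
        klBubbleMaj L M β μ K (softSymbolCompl L M β μ K n (n + 1)) (fun k => ψ₁ k - ψ₂ k) Qm c) := by
  -- the value of `a t c` as ONE real number
  have e : a t c = (((-klBubbleMass L M β μ K
        (fun k => ψ₁ k + (hubbardCutoffWeightCT L M β μ K (klScale klE0 (n + 1)) k -
          hubbardCutoffWeightCT L M β μ K (klScale klE0 n + t * (klScale klE0 (n + 1) - klScale klE0 n)) k))
        (fun k => ψ₁ k + (hubbardCutoffWeightCT L M β μ K (klScale klE0 (n + 1)) k -
          hubbardCutoffWeightCT L M β μ K (klScale klE0 n + t * (klScale klE0 (n + 1) - klScale klE0 n)) k)) Qm c - -klBubbleMass L M β μ K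
        (fun k => ψ₂ k + (hubbardCutoffWeightCT L M β μ K (klScale klE0 (n + 1)) k -
          hubbardCutoffWeightCT L M β μ K (klScale klE0 n + t * (klScale klE0 (n + 1) - klScale klE0 n)) k))
        (fun k => ψ₂ k + (hubbardCutoffWeightCT L M β μ K (klScale klE0 (n + 1)) k -
          hubbardCutoffWeightCT L M β μ K (klScale klE0 n + t * (klScale klE0 (n + 1) - klScale klE0 n)) k)) Qm c) +
      (-(klTransferWeight L M β μ K (n + 1) ψ₁ Qm c - klTransferWeight L M β μ K (n + 1) ψ₂ Qm c) - (-klBubbleMass L M β μ K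
        (fun k => ψ₁ k + (hubbardCutoffWeightCT L M β μ K (klScale klE0 (n + 1)) k -
          hubbardCutoffWeightCT L M β μ K (klScale klE0 n + 1 * (klScale klE0 (n + 1) - klScale klE0 n)) k))
        (fun k => ψ₁ k + (hubbardCutoffWeightCT L M β μ K (klScale klE0 (n + 1)) k -
          hubbardCutoffWeightCT L M β μ K (klScale klE0 n + 1 * (klScale klE0 (n + 1) - klScale klE0 n)) k)) Qm c -
        -klBubbleMass L M β μ K
        (fun k => ψ₂ k + (hubbardCutoffWeightCT L M β μ K (klScale klE0 (n + 1)) k -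
          hubbardCutoffWeightCT L M β μ K (klScale klE0 n + 1 * (klScale klE0 (n + 1) - klScale klE0 n)) k))
        (fun k => ψ₂ k + (hubbardCutoffWeightCT L M β μ K (klScale klE0 (n + 1)) k -
          hubbardCutoffWeightCT L M β μ K (klScale klE0 n + 1 * (klScale klE0 (n + 1) - klScale klE0 n)) k)) Qm c)) : ℝ) : ℂ) := by
    rw [hadef, hb₁def, hb₂def]
    push_cast
    ring
  rw [e, Complex.norm_real, Real.norm_eq_abs]
  have hv := klrw_relWeight_value β μ K ψ₁ ψ₂ (fun k => (hubbardCutoffWeightCT L M β μ K (klScale klE0 (n + 1)) k -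
          hubbardCutoffWeightCT L M β μ K (klScale klE0 n + t * (klScale klE0 (n + 1) - klScale klE0 n)) k))
      (fun k => (hubbardCutoffWeightCT L M β μ K (klScale klE0 (n + 1)) k -
          hubbardCutoffWeightCT L M β μ K (klScale klE0 n + 1 * (klScale klE0 (n + 1) - klScale klE0 n)) k)) (klTransferWeight L M β μ K (n + 1) ψ₁ Qm c - klTransferWeight L M β μ K (n + 1) ψ₂ Qm c) Qm c
  beta_reduce at hv
  rw [hv]
  -- the running part at time `t` minus that at time `1` is `w_(Λ_(n+1)) − w_(Λ(t)) ∈ [0, s]` pointwise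
  have hδbd : ∀ k, |(hubbardCutoffWeightCT L M β μ K (klScale klE0 (n + 1)) k -
          hubbardCutoffWeightCT L M β μ K (klScale klE0 n + t * (klScale klE0 (n + 1) - klScale klE0 n)) k) -
        (hubbardCutoffWeightCT L M β μ K (klScale klE0 (n + 1)) k -
          hubbardCutoffWeightCT L M β μ K (klScale klE0 n + 1 * (klScale klE0 (n + 1) - klScale klE0 n)) k)| ≤
      |softSymbolCompl L M β μ K n (n + 1) k| := fun k => by
    obtain ⟨h0, h1⟩ := runningSlice_mem (L := L) (M := M) β μ K n ht k
    have h1' := runningSlice_mem (L := L) (M := M) β μ K n (show (1 : ℝ) ∈ Icc (0 : ℝ) 1 from ⟨zero_le_one, le_rfl⟩) k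
    simp only [one_mul, add_sub_cancel] at h1' ⊢
    simp only [softSymbolCompl] at h1 h1' ⊢
    rw [abs_of_nonneg h1'.1, abs_le]
    constructor <;> linarith [h1'.1, h1'.2]
  have hrefl : ∀ k, |(fun k => ψ₁ k - ψ₂ k) k| ≤ |(fun k => ψ₁ k - ψ₂ k) k| := fun _ => le_rfl
  have hX := (abs_klBubbleMass_le_klBubbleMaj β μ K hβ (fun k => ψ₁ k - ψ₂ k)
      (fun k => (hubbardCutoffWeightCT L M β μ K (klScale klE0 (n + 1)) k -
          hubbardCutoffWeightCT L M β μ K (klScale klE0 n + t * (klScale klE0 (n + 1) - klScale klE0 n)) k) -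
        (hubbardCutoffWeightCT L M β μ K (klScale klE0 (n + 1)) k -
          hubbardCutoffWeightCT L M β μ K (klScale klE0 n + 1 * (klScale klE0 (n + 1) - klScale klE0 n)) k)) Qm c).trans
    (klBubbleMaj_mono β μ K hβ hrefl hδbd Qm c)
  have hY := (abs_klBubbleMass_le_klBubbleMaj β μ K hβ
      (fun k => (hubbardCutoffWeightCT L M β μ K (klScale klE0 (n + 1)) k -
          hubbardCutoffWeightCT L M β μ K (klScale klE0 n + t * (klScale klE0 (n + 1) - klScale klE0 n)) k) -
        (hubbardCutoffWeightCT L M β μ K (klScale klE0 (n + 1)) k -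
          hubbardCutoffWeightCT L M β μ K (klScale klE0 n + 1 * (klScale klE0 (n + 1) - klScale klE0 n)) k)) (fun k => ψ₁ k - ψ₂ k) Qm c).trans
    (klBubbleMaj_mono β μ K hβ hδbd hrefl Qm c)
  rw [show ∀ (T X : ℝ), -T - X = -(T + X) from fun T X => by ring, abs_neg]
  exact (abs_add_le _ _).trans (add_le_add le_rfl ((abs_add_le _ _).trans (add_le_add hX hY)))

end RelWeightProfile

end Summit.HubbardSuperconductivity.HubbardSuperconductivity.Theorems.KLRegimeSplit

end
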